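import Summits.ValiantsHypothesis.ValiantsHypothesis.Theorems.KPlusLogSqLawTropicalBToeplitzSmallSizes

/-!
# Route `KPlusLogSqLaw`, crux `TropicalB` — Toeplitz sector: the first rows of the FRAMELESS core, `Φ⁰_Toep(3) = 2`, `Φ⁰_Toep(4) = 5`, `Φ⁰_Toep(5) = 10`

HONEST FRAMING.  Helper toward the registered stubs `stub_tropThin` / `stub_tropFat` of
`Cruxes/TropicalB/Lines/birth.lean` (crux `Summit.ValiantsHypothesis.ValiantsHypothesis.Theses.KPlusLogSqLaw.TropicalB`,
ledger item `stmt-ValiantsHypothesis-19771`, route `KPlusLogSqLaw`; cell `pub-symmetroid`, seat `val-sym-trop-p3`,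
2026-08-26).  KERNEL ROWS of the frameless sub-count `Toeplitz.FramelessInstanceBound m Φ` («`Φ⁰_Toep(m) ≤ Φ`»: chains all of
whose members are `Frameless` — no proper window mapped into itself; the cell's `ConjectureT0`, the named hard core of
Conjecture T per method memo CONJT-METHOD-g22 §3.4 (e)).  Conjecture T⁰ (`O(m)`) is OPEN; nothing here bears on `TropicalB` for
general designs, `KPlusLogSqLaw`, `MatrixDescartes` or `VP ≠ VNP`.

THE RESULTS.
* `frameless_iff_range` — `Frameless τ` in a bounded (decidable) form.
* EXACT ROWS `framelessInstanceBound_three_iff : … ↔ 2 ≤ Φ`, `framelessInstanceBound_four_iff : … ↔ 5 ≤ Φ`,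
  `framelessInstanceBound_five_iff : … ↔ 10 ≤ Φ`: the upper side counts the frameless permutations with an UNSHARED profile
  (`2, 5, 10` at `m = 3, 4, 5`, `decide`); the lower side is the frameless part of this seat's instances (`three_chain_4`,
  `four_chain_8`, `five_chain_13` realise ALL frameless unshared-profile permutations).  DATUM: at `m ≤ 5` the frameless core is
  SATURATED (every frameless unshared-profile permutation occurs in one chain; the ten at `m = 5` carry no additive relation),
  while the deficit `U(5) − Φ_Toep(5)` (20 vs located 13) sits entirely in the FRAMED permutations — a calibration point for
  `ConjectureT0` (`Φ⁰_Toep(m)/m = 0.67, 1.25, 2.0` at `m = 3, 4, 5`; located `≈ 1.8–2.25` at `m = 6..10`).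

References: folklore; `…ToeplitzConjectureT` (`Frameless`, `FramelessInstanceBound`), `…ToeplitzAdditive`, `…ToeplitzSmallSizes`.
-/

set_option linter.dupNamespace false
set_option autoImplicit false

namespace Summit.ValiantsHypothesis.ValiantsHypothesis.Theorems.KPlusLogSqLaw.Toeplitz

open scoped BigOperators
open Finset

section Bounded

variable {m : ℕ}

/-- `Frameless` in bounded form (window start and length below `m`), so that it is decidable by enumeration. -/
theorem frameless_iff_range (τ : Equiv.Perm (Fin m)) :
    Frameless τ ↔ ∀ a ∈ range m, ∀ ℓ ∈ range m, 1 ≤ ℓ → a + ℓ ≤ m →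
      ∃ b : Fin m, a ≤ (b : ℕ) ∧ (b : ℕ) < a + ℓ ∧ ¬ (a ≤ (τ b : ℕ) ∧ (τ b : ℕ) < a + ℓ) := by
  constructor
  · intro h a _ ℓ hℓ h1 ham
    exact h a ℓ h1 (mem_range.mp hℓ) ham
  · intro h a ℓ h1 hℓ ham
    exact h a (mem_range.mpr (by omega)) ℓ (mem_range.mpr hℓ) h1 ham

end Bounded

/-! ## `m = 3`: `Φ⁰_Toep(3) = 2` -/

section Three

/-- `2` permutations of `Fin 3` are frameless with an unshared profile (`decide`). -/
theorem card_framelessUnshared_three :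
    ((univ.filter fun σ : Equiv.Perm (Fin 3) => ∀ σ' : Equiv.Perm (Fin 3),
      (univ.val.map fun b : Fin 3 => (σ' b : ℤ) - b) = (univ.val.map fun b : Fin 3 => (σ b : ℤ) - b) → σ' = σ).filter fun σ : Equiv.Perm (Fin 3) =>
      ∀ a ∈ range 3, ∀ ℓ ∈ range 3, 1 ≤ ℓ → a + ℓ ≤ 3 →
        ∃ b : Fin 3, a ≤ (b : ℕ) ∧ (b : ℕ) < a + ℓ ∧ ¬ (a ≤ (σ b : ℕ) ∧ (σ b : ℕ) < a + ℓ)).card = 2 := by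
  decide

/-- **`Φ⁰_Toep(3) ≤ 2`**: the members of an all-frameless chain are frameless with unshared profiles. -/
theorem framelessInstanceBound_three : FramelessInstanceBound 3 2 := by
  intro ψ α P N θ' τ hθ hinj hfr hτP huniq
  classical
  have hsub : univ.image τ ⊆ (univ.filter fun σ : Equiv.Perm (Fin 3) => ∀ σ' : Equiv.Perm (Fin 3),
      (univ.val.map fun b : Fin 3 => (σ' b : ℤ) - b) = (univ.val.map fun b : Fin 3 => (σ b : ℤ) - b) → σ' = σ).filter fun σ : Equiv.Perm (Fin 3) =>
      ∀ a ∈ range 3, ∀ ℓ ∈ range 3, 1 ≤ ℓ → a + ℓ ≤ 3 →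
        ∃ b : Fin 3, a ≤ (b : ℕ) ∧ (b : ℕ) < a + ℓ ∧ ¬ (a ≤ (σ b : ℕ) ∧ (σ b : ℕ) < a + ℓ) := by
    intro σ hσ
    obtain ⟨k, -, rfl⟩ := mem_image.mp hσ
    rw [mem_filter]
    exact ⟨image_subset_unshared ψ α P θ' τ hτP huniq hσ, (frameless_iff_range (τ k)).mp (hfr k)⟩
  have hcard : (univ.image τ).card = N + 1 := by
    rw [card_image_of_injective _ hinj, card_univ, Fintype.card_fin]
  have h := card_le_card hsub
  rw [hcard] at h
  exact h.trans (le_of_eq (by convert card_framelessUnshared_three))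

/-- **`Φ⁰_Toep(3) ≥ 2`: an explicit all-frameless chain with `2` members** (the frameless members of this seat's
`m = 3` instance of `…ToeplitzSmallSizes` / `…ToeplitzFive`). [folklore] -/
theorem frameless_three_chain_2 :
    ∃ (ψ α : ℤ → ℤ) (θ' : Fin 2 → ℤ) (τ : Fin 2 → Equiv.Perm (Fin 3)),
      StrictMono θ' ∧ Function.Injective τ ∧ (∀ k, Frameless (τ k)) ∧
      ∀ k (σ : Equiv.Perm (Fin 3)), σ ≠ τ k →
        ∑ b, (θ' k * ψ ((σ b : ℤ) - b) + α ((σ b : ℤ) - b)) <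
          ∑ b, (θ' k * ψ ((τ k b : ℤ) - b) + α ((τ k b : ℤ) - b)) := by
  -- instance: ψ = [0, 0, 1, 0, 1] , α = [0, 0, -2, 2, 4] on δ = -2..2; frameless members ['120', '201'] at θ = [-3, 1]
  let ψᵢ : ℤ → ℤ := fun δ : ℤ => if δ = -2 then 0 else if δ = -1 then 0 else if δ = 0 then 1 else if δ = 1 then 0 else if δ = 2 then 1 else 0
  let αᵢ : ℤ → ℤ := fun δ : ℤ => if δ = -2 then 0 else if δ = -1 then 0 else if δ = 0 then -2 else if δ = 1 then 2 else if δ = 2 then 4 else 0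
  let τ0 : Equiv.Perm (Fin 3) := (⟨![1, 2, 0], ![2, 0, 1], by decide, by decide⟩ : Equiv.Perm (Fin 3))
  let τ1 : Equiv.Perm (Fin 3) := (⟨![2, 0, 1], ![1, 2, 0], by decide, by decide⟩ : Equiv.Perm (Fin 3))
  let θs : Fin 2 → ℤ := ![-3, 1]
  let τs : Fin 2 → Equiv.Perm (Fin 3) := ![τ0, τ1]
  have h0 : ∀ σ : Equiv.Perm (Fin 3), σ ≠ τ0 →
      ∑ b, ((-3 : ℤ) * ψᵢ ((σ b : ℤ) - b) + αᵢ ((σ b : ℤ) - b)) < ∑ b, ((-3 : ℤ) * ψᵢ ((τ0 b : ℤ) - b) + αᵢ ((τ0 b : ℤ) - b)) := by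
    decide
  have h1 : ∀ σ : Equiv.Perm (Fin 3), σ ≠ τ1 →
      ∑ b, ((1 : ℤ) * ψᵢ ((σ b : ℤ) - b) + αᵢ ((σ b : ℤ) - b)) < ∑ b, ((1 : ℤ) * ψᵢ ((τ1 b : ℤ) - b) + αᵢ ((τ1 b : ℤ) - b)) := by
    decide
  refine ⟨ψᵢ, αᵢ, θs, τs, Fin.strictMono_iff_lt_succ.mpr (by decide), by decide, fun k => ?_, fun k => ?_⟩
  · fin_cases k <;> exact (frameless_iff_range _).mpr (by decide)
  · fin_cases k
    · exact h0
    · exact h1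

/-- `Φ⁰_Toep(3) > 1`. -/
theorem not_framelessInstanceBound_three_1 : ¬ FramelessInstanceBound 3 1 := by
  intro h
  obtain ⟨ψ, α, θ', τ, hθ, hτ, hfr, hu⟩ := frameless_three_chain_2
  have := h ψ α (fun _ => True) 1 θ' τ hθ hτ hfr (fun _ _ => trivial) (fun k σ hσ _ => hu k σ hσ)
  omega

/-- **EXACT ROW `Φ⁰_Toep(3) = 2`.** -/
theorem framelessInstanceBound_three_iff (Φ : ℕ) : FramelessInstanceBound 3 Φ ↔ 2 ≤ Φ :=
  ⟨fun h => by
    by_contra hh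
    exact not_framelessInstanceBound_three_1 (fun ψ α P N θ' τ a b c d e => (h ψ α P N θ' τ a b c d e).trans (by omega)),
   fun h ψ α P N θ' τ a b c d e => (framelessInstanceBound_three ψ α P N θ' τ a b c d e).trans h⟩

end Three

/-! ## `m = 4`: `Φ⁰_Toep(4) = 5` -/

section Four

/-- `5` permutations of `Fin 4` are frameless with an unshared profile (`decide`). -/
theorem card_framelessUnshared_four :
    ((univ.filter fun σ : Equiv.Perm (Fin 4) => ∀ σ' : Equiv.Perm (Fin 4),
      (univ.val.map fun b : Fin 4 => (σ' b : ℤ) - b) = (univ.val.map fun b : Fin 4 => (σ b : ℤ) - b) → σ' = σ).filter fun σ : Equiv.Perm (Fin 4) =>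
      ∀ a ∈ range 4, ∀ ℓ ∈ range 4, 1 ≤ ℓ → a + ℓ ≤ 4 →
        ∃ b : Fin 4, a ≤ (b : ℕ) ∧ (b : ℕ) < a + ℓ ∧ ¬ (a ≤ (σ b : ℕ) ∧ (σ b : ℕ) < a + ℓ)).card = 5 := by
  decide

/-- **`Φ⁰_Toep(4) ≤ 5`**: the members of an all-frameless chain are frameless with unshared profiles. -/
theorem framelessInstanceBound_four : FramelessInstanceBound 4 5 := by
  intro ψ α P N θ' τ hθ hinj hfr hτP huniq
  classical
  have hsub : univ.image τ ⊆ (univ.filter fun σ : Equiv.Perm (Fin 4) => ∀ σ' : Equiv.Perm (Fin 4),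
      (univ.val.map fun b : Fin 4 => (σ' b : ℤ) - b) = (univ.val.map fun b : Fin 4 => (σ b : ℤ) - b) → σ' = σ).filter fun σ : Equiv.Perm (Fin 4) =>
      ∀ a ∈ range 4, ∀ ℓ ∈ range 4, 1 ≤ ℓ → a + ℓ ≤ 4 →
        ∃ b : Fin 4, a ≤ (b : ℕ) ∧ (b : ℕ) < a + ℓ ∧ ¬ (a ≤ (σ b : ℕ) ∧ (σ b : ℕ) < a + ℓ) := by
    intro σ hσ
    obtain ⟨k, -, rfl⟩ := mem_image.mp hσ
    rw [mem_filter]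
    exact ⟨image_subset_unshared ψ α P θ' τ hτP huniq hσ, (frameless_iff_range (τ k)).mp (hfr k)⟩
  have hcard : (univ.image τ).card = N + 1 := by
    rw [card_image_of_injective _ hinj, card_univ, Fintype.card_fin]
  have h := card_le_card hsub
  rw [hcard] at h
  exact h.trans (le_of_eq (by convert card_framelessUnshared_four))

/-- **`Φ⁰_Toep(4) ≥ 5`: an explicit all-frameless chain with `5` members** (the frameless members of this seat's
`m = 4` instance of `…ToeplitzSmallSizes` / `…ToeplitzFive`). [folklore] -/
theorem frameless_four_chain_5 :
    ∃ (ψ α : ℤ → ℤ) (θ' : Fin 5 → ℤ) (τ : Fin 5 → Equiv.Perm (Fin 4)),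
      StrictMono θ' ∧ Function.Injective τ ∧ (∀ k, Frameless (τ k)) ∧
      ∀ k (σ : Equiv.Perm (Fin 4)), σ ≠ τ k →
        ∑ b, (θ' k * ψ ((σ b : ℤ) - b) + α ((σ b : ℤ) - b)) <
          ∑ b, (θ' k * ψ ((τ k b : ℤ) - b) + α ((τ k b : ℤ) - b)) := by
  -- instance: ψ = [4, 5, 0, 5, 3, 3, 4] , α = [72, 36, -28, 10, 64, 76, 46] on δ = -3..3; frameless members ['3012', '2310', '1230', '2301', '3201'] at θ = [-58, -30, -22, 14, 43]
  let ψᵢ : ℤ → ℤ := fun δ : ℤ => if δ = -3 then 4 else if δ = -2 then 5 else if δ = -1 then 0 else if δ = 0 then 5 else if δ = 1 then 3 else if δ = 2 then 3 else if δ = 3 then 4 else 0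
  let αᵢ : ℤ → ℤ := fun δ : ℤ => if δ = -3 then 72 else if δ = -2 then 36 else if δ = -1 then -28 else if δ = 0 then 10 else if δ = 1 then 64 else if δ = 2 then 76 else if δ = 3 then 46 else 0
  let τ0 : Equiv.Perm (Fin 4) := (⟨![3, 0, 1, 2], ![1, 2, 3, 0], by decide, by decide⟩ : Equiv.Perm (Fin 4))
  let τ1 : Equiv.Perm (Fin 4) := (⟨![2, 3, 1, 0], ![3, 2, 0, 1], by decide, by decide⟩ : Equiv.Perm (Fin 4))
  let τ2 : Equiv.Perm (Fin 4) := (⟨![1, 2, 3, 0], ![3, 0, 1, 2], by decide, by decide⟩ : Equiv.Perm (Fin 4))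
  let τ3 : Equiv.Perm (Fin 4) := (⟨![2, 3, 0, 1], ![2, 3, 0, 1], by decide, by decide⟩ : Equiv.Perm (Fin 4))
  let τ4 : Equiv.Perm (Fin 4) := (⟨![3, 2, 0, 1], ![2, 3, 1, 0], by decide, by decide⟩ : Equiv.Perm (Fin 4))
  let θs : Fin 5 → ℤ := ![-58, -30, -22, 14, 43]
  let τs : Fin 5 → Equiv.Perm (Fin 4) := ![τ0, τ1, τ2, τ3, τ4]
  have h0 : ∀ σ : Equiv.Perm (Fin 4), σ ≠ τ0 →
      ∑ b, ((-58 : ℤ) * ψᵢ ((σ b : ℤ) - b) + αᵢ ((σ b : ℤ) - b)) < ∑ b, ((-58 : ℤ) * ψᵢ ((τ0 b : ℤ) - b) + αᵢ ((τ0 b : ℤ) - b)) := by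
    decide
  have h1 : ∀ σ : Equiv.Perm (Fin 4), σ ≠ τ1 →
      ∑ b, ((-30 : ℤ) * ψᵢ ((σ b : ℤ) - b) + αᵢ ((σ b : ℤ) - b)) < ∑ b, ((-30 : ℤ) * ψᵢ ((τ1 b : ℤ) - b) + αᵢ ((τ1 b : ℤ) - b)) := by
    decide
  have h2 : ∀ σ : Equiv.Perm (Fin 4), σ ≠ τ2 →
      ∑ b, ((-22 : ℤ) * ψᵢ ((σ b : ℤ) - b) + αᵢ ((σ b : ℤ) - b)) < ∑ b, ((-22 : ℤ) * ψᵢ ((τ2 b : ℤ) - b) + αᵢ ((τ2 b : ℤ) - b)) := by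
    decide
  have h3 : ∀ σ : Equiv.Perm (Fin 4), σ ≠ τ3 →
      ∑ b, ((14 : ℤ) * ψᵢ ((σ b : ℤ) - b) + αᵢ ((σ b : ℤ) - b)) < ∑ b, ((14 : ℤ) * ψᵢ ((τ3 b : ℤ) - b) + αᵢ ((τ3 b : ℤ) - b)) := by
    decide
  have h4 : ∀ σ : Equiv.Perm (Fin 4), σ ≠ τ4 →
      ∑ b, ((43 : ℤ) * ψᵢ ((σ b : ℤ) - b) + αᵢ ((σ b : ℤ) - b)) < ∑ b, ((43 : ℤ) * ψᵢ ((τ4 b : ℤ) - b) + αᵢ ((τ4 b : ℤ) - b)) := by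
    decide
  refine ⟨ψᵢ, αᵢ, θs, τs, Fin.strictMono_iff_lt_succ.mpr (by decide), by decide, fun k => ?_, fun k => ?_⟩
  · fin_cases k <;> exact (frameless_iff_range _).mpr (by decide)
  · fin_cases k
    · exact h0
    · exact h1
    · exact h2
    · exact h3
    · exact h4

/-- `Φ⁰_Toep(4) > 4`. -/
theorem not_framelessInstanceBound_four_4 : ¬ FramelessInstanceBound 4 4 := by
  intro h
  obtain ⟨ψ, α, θ', τ, hθ, hτ, hfr, hu⟩ := frameless_four_chain_5
  have := h ψ α (fun _ => True) 4 θ' τ hθ hτ hfr (fun _ _ => trivial) (fun k σ hσ _ => hu k σ hσ)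
  omega

/-- **EXACT ROW `Φ⁰_Toep(4) = 5`.** -/
theorem framelessInstanceBound_four_iff (Φ : ℕ) : FramelessInstanceBound 4 Φ ↔ 5 ≤ Φ :=
  ⟨fun h => by
    by_contra hh
    exact not_framelessInstanceBound_four_4 (fun ψ α P N θ' τ a b c d e => (h ψ α P N θ' τ a b c d e).trans (by omega)),
   fun h ψ α P N θ' τ a b c d e => (framelessInstanceBound_four ψ α P N θ' τ a b c d e).trans h⟩

end Four

/-! ## `m = 5`: `Φ⁰_Toep(5) = 10` -/

section Five

/-- `10` permutations of `Fin 5` are frameless with an unshared profile (`decide +kernel`). -/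
theorem card_framelessUnshared_five :
    ((univ.filter fun σ : Equiv.Perm (Fin 5) => ∀ σ' : Equiv.Perm (Fin 5),
      (univ.val.map fun b : Fin 5 => (σ' b : ℤ) - b) = (univ.val.map fun b : Fin 5 => (σ b : ℤ) - b) → σ' = σ).filter fun σ : Equiv.Perm (Fin 5) =>
      ∀ a ∈ range 5, ∀ ℓ ∈ range 5, 1 ≤ ℓ → a + ℓ ≤ 5 →
        ∃ b : Fin 5, a ≤ (b : ℕ) ∧ (b : ℕ) < a + ℓ ∧ ¬ (a ≤ (σ b : ℕ) ∧ (σ b : ℕ) < a + ℓ)).card = 10 := by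
  decide +kernel

/-- **`Φ⁰_Toep(5) ≤ 10`**: the members of an all-frameless chain are frameless with unshared profiles. -/
theorem framelessInstanceBound_five : FramelessInstanceBound 5 10 := by
  intro ψ α P N θ' τ hθ hinj hfr hτP huniq
  classical
  have hsub : univ.image τ ⊆ (univ.filter fun σ : Equiv.Perm (Fin 5) => ∀ σ' : Equiv.Perm (Fin 5),
      (univ.val.map fun b : Fin 5 => (σ' b : ℤ) - b) = (univ.val.map fun b : Fin 5 => (σ b : ℤ) - b) → σ' = σ).filter fun σ : Equiv.Perm (Fin 5) =>
      ∀ a ∈ range 5, ∀ ℓ ∈ range 5, 1 ≤ ℓ → a + ℓ ≤ 5 →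
        ∃ b : Fin 5, a ≤ (b : ℕ) ∧ (b : ℕ) < a + ℓ ∧ ¬ (a ≤ (σ b : ℕ) ∧ (σ b : ℕ) < a + ℓ) := by
    intro σ hσ
    obtain ⟨k, -, rfl⟩ := mem_image.mp hσ
    rw [mem_filter]
    exact ⟨image_subset_unshared ψ α P θ' τ hτP huniq hσ, (frameless_iff_range (τ k)).mp (hfr k)⟩
  have hcard : (univ.image τ).card = N + 1 := by
    rw [card_image_of_injective _ hinj, card_univ, Fintype.card_fin]
  have h := card_le_card hsub
  rw [hcard] at h
  exact h.trans (le_of_eq (by convert card_framelessUnshared_five))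

/-- **`Φ⁰_Toep(5) ≥ 10`: an explicit all-frameless chain with `10` members** (the frameless members of this seat's
`m = 5` instance of `…ToeplitzSmallSizes` / `…ToeplitzFive`). [folklore] -/
theorem frameless_five_chain_10 :
    ∃ (ψ α : ℤ → ℤ) (θ' : Fin 10 → ℤ) (τ : Fin 10 → Equiv.Perm (Fin 5)),
      StrictMono θ' ∧ Function.Injective τ ∧ (∀ k, Frameless (τ k)) ∧
      ∀ k (σ : Equiv.Perm (Fin 5)), σ ≠ τ k →
        ∑ b, (θ' k * ψ ((σ b : ℤ) - b) + α ((σ b : ℤ) - b)) <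
          ∑ b, (θ' k * ψ ((τ k b : ℤ) - b) + α ((τ k b : ℤ) - b)) := by
  -- instance: ψ = [7, 34, 14, 14, 8, 32, 24, 11, 14] , α = [29166, -67355, 31329, 18150, -37462, -20638, 3103, -39795, -37453] on δ = -4..4; frameless members ['34120', '34012', '40123', '43012', '20413', '23410', '13042', '12340', '23401', '42301'] at θ = [-7072, -4074, -3458, -2448, -1419, 1344, 1971, 4099, 14404, 14676]
  let ψᵢ : ℤ → ℤ := fun δ : ℤ => if δ = -4 then 7 else if δ = -3 then 34 else if δ = -2 then 14 else if δ = -1 then 14 else if δ = 0 then 8 else if δ = 1 then 32 else if δ = 2 then 24 else if δ = 3 then 11 else if δ = 4 then 14 else 0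
  let αᵢ : ℤ → ℤ := fun δ : ℤ => if δ = -4 then 29166 else if δ = -3 then -67355 else if δ = -2 then 31329 else if δ = -1 then 18150 else if δ = 0 then -37462 else if δ = 1 then -20638 else if δ = 2 then 3103 else if δ = 3 then -39795 else if δ = 4 then -37453 else 0
  let τ0 : Equiv.Perm (Fin 5) := (⟨![3, 4, 1, 2, 0], ![4, 2, 3, 0, 1], by decide, by decide⟩ : Equiv.Perm (Fin 5))
  let τ1 : Equiv.Perm (Fin 5) := (⟨![3, 4, 0, 1, 2], ![2, 3, 4, 0, 1], by decide, by decide⟩ : Equiv.Perm (Fin 5))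
  let τ2 : Equiv.Perm (Fin 5) := (⟨![4, 0, 1, 2, 3], ![1, 2, 3, 4, 0], by decide, by decide⟩ : Equiv.Perm (Fin 5))
  let τ3 : Equiv.Perm (Fin 5) := (⟨![4, 3, 0, 1, 2], ![2, 3, 4, 1, 0], by decide, by decide⟩ : Equiv.Perm (Fin 5))
  let τ4 : Equiv.Perm (Fin 5) := (⟨![2, 0, 4, 1, 3], ![1, 3, 0, 4, 2], by decide, by decide⟩ : Equiv.Perm (Fin 5))
  let τ5 : Equiv.Perm (Fin 5) := (⟨![2, 3, 4, 1, 0], ![4, 3, 0, 1, 2], by decide, by decide⟩ : Equiv.Perm (Fin 5))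
  let τ6 : Equiv.Perm (Fin 5) := (⟨![1, 3, 0, 4, 2], ![2, 0, 4, 1, 3], by decide, by decide⟩ : Equiv.Perm (Fin 5))
  let τ7 : Equiv.Perm (Fin 5) := (⟨![1, 2, 3, 4, 0], ![4, 0, 1, 2, 3], by decide, by decide⟩ : Equiv.Perm (Fin 5))
  let τ8 : Equiv.Perm (Fin 5) := (⟨![2, 3, 4, 0, 1], ![3, 4, 0, 1, 2], by decide, by decide⟩ : Equiv.Perm (Fin 5))
  let τ9 : Equiv.Perm (Fin 5) := (⟨![4, 2, 3, 0, 1], ![3, 4, 1, 2, 0], by decide, by decide⟩ : Equiv.Perm (Fin 5))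
  let θs : Fin 10 → ℤ := ![-7072, -4074, -3458, -2448, -1419, 1344, 1971, 4099, 14404, 14676]
  let τs : Fin 10 → Equiv.Perm (Fin 5) := ![τ0, τ1, τ2, τ3, τ4, τ5, τ6, τ7, τ8, τ9]
  have h0 : ∀ σ : Equiv.Perm (Fin 5), σ ≠ τ0 →
      ∑ b, ((-7072 : ℤ) * ψᵢ ((σ b : ℤ) - b) + αᵢ ((σ b : ℤ) - b)) < ∑ b, ((-7072 : ℤ) * ψᵢ ((τ0 b : ℤ) - b) + αᵢ ((τ0 b : ℤ) - b)) := by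
    decide +kernel
  have h1 : ∀ σ : Equiv.Perm (Fin 5), σ ≠ τ1 →
      ∑ b, ((-4074 : ℤ) * ψᵢ ((σ b : ℤ) - b) + αᵢ ((σ b : ℤ) - b)) < ∑ b, ((-4074 : ℤ) * ψᵢ ((τ1 b : ℤ) - b) + αᵢ ((τ1 b : ℤ) - b)) := by
    decide +kernel
  have h2 : ∀ σ : Equiv.Perm (Fin 5), σ ≠ τ2 →
      ∑ b, ((-3458 : ℤ) * ψᵢ ((σ b : ℤ) - b) + αᵢ ((σ b : ℤ) - b)) < ∑ b, ((-3458 : ℤ) * ψᵢ ((τ2 b : ℤ) - b) + αᵢ ((τ2 b : ℤ) - b)) := by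
    decide +kernel
  have h3 : ∀ σ : Equiv.Perm (Fin 5), σ ≠ τ3 →
      ∑ b, ((-2448 : ℤ) * ψᵢ ((σ b : ℤ) - b) + αᵢ ((σ b : ℤ) - b)) < ∑ b, ((-2448 : ℤ) * ψᵢ ((τ3 b : ℤ) - b) + αᵢ ((τ3 b : ℤ) - b)) := by
    decide +kernel
  have h4 : ∀ σ : Equiv.Perm (Fin 5), σ ≠ τ4 →
      ∑ b, ((-1419 : ℤ) * ψᵢ ((σ b : ℤ) - b) + αᵢ ((σ b : ℤ) - b)) < ∑ b, ((-1419 : ℤ) * ψᵢ ((τ4 b : ℤ) - b) + αᵢ ((τ4 b : ℤ) - b)) := by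
    decide +kernel
  have h5 : ∀ σ : Equiv.Perm (Fin 5), σ ≠ τ5 →
      ∑ b, ((1344 : ℤ) * ψᵢ ((σ b : ℤ) - b) + αᵢ ((σ b : ℤ) - b)) < ∑ b, ((1344 : ℤ) * ψᵢ ((τ5 b : ℤ) - b) + αᵢ ((τ5 b : ℤ) - b)) := by
    decide +kernel
  have h6 : ∀ σ : Equiv.Perm (Fin 5), σ ≠ τ6 →
      ∑ b, ((1971 : ℤ) * ψᵢ ((σ b : ℤ) - b) + αᵢ ((σ b : ℤ) - b)) < ∑ b, ((1971 : ℤ) * ψᵢ ((τ6 b : ℤ) - b) + αᵢ ((τ6 b : ℤ) - b)) := by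
    decide +kernel
  have h7 : ∀ σ : Equiv.Perm (Fin 5), σ ≠ τ7 →
      ∑ b, ((4099 : ℤ) * ψᵢ ((σ b : ℤ) - b) + αᵢ ((σ b : ℤ) - b)) < ∑ b, ((4099 : ℤ) * ψᵢ ((τ7 b : ℤ) - b) + αᵢ ((τ7 b : ℤ) - b)) := by
    decide +kernel
  have h8 : ∀ σ : Equiv.Perm (Fin 5), σ ≠ τ8 →
      ∑ b, ((14404 : ℤ) * ψᵢ ((σ b : ℤ) - b) + αᵢ ((σ b : ℤ) - b)) < ∑ b, ((14404 : ℤ) * ψᵢ ((τ8 b : ℤ) - b) + αᵢ ((τ8 b : ℤ) - b)) := by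
    decide +kernel
  have h9 : ∀ σ : Equiv.Perm (Fin 5), σ ≠ τ9 →
      ∑ b, ((14676 : ℤ) * ψᵢ ((σ b : ℤ) - b) + αᵢ ((σ b : ℤ) - b)) < ∑ b, ((14676 : ℤ) * ψᵢ ((τ9 b : ℤ) - b) + αᵢ ((τ9 b : ℤ) - b)) := by
    decide +kernel
  refine ⟨ψᵢ, αᵢ, θs, τs, Fin.strictMono_iff_lt_succ.mpr (by decide), by decide, fun k => ?_, fun k => ?_⟩
  · fin_cases k <;> exact (frameless_iff_range _).mpr (by decide)
  · fin_cases k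
    · exact h0
    · exact h1
    · exact h2
    · exact h3
    · exact h4
    · exact h5
    · exact h6
    · exact h7
    · exact h8
    · exact h9

/-- `Φ⁰_Toep(5) > 9`. -/
theorem not_framelessInstanceBound_five_9 : ¬ FramelessInstanceBound 5 9 := by
  intro h
  obtain ⟨ψ, α, θ', τ, hθ, hτ, hfr, hu⟩ := frameless_five_chain_10
  have := h ψ α (fun _ => True) 9 θ' τ hθ hτ hfr (fun _ _ => trivial) (fun k σ hσ _ => hu k σ hσ)
  omega

/-- **EXACT ROW `Φ⁰_Toep(5) = 10`.** -/
theorem framelessInstanceBound_five_iff (Φ : ℕ) : FramelessInstanceBound 5 Φ ↔ 10 ≤ Φ :=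
  ⟨fun h => by
    by_contra hh
    exact not_framelessInstanceBound_five_9 (fun ψ α P N θ' τ a b c d e => (h ψ α P N θ' τ a b c d e).trans (by omega)),
   fun h ψ α P N θ' τ a b c d e => (framelessInstanceBound_five ψ α P N θ' τ a b c d e).trans h⟩

end Five

end Summit.ValiantsHypothesis.ValiantsHypothesis.Theorems.KPlusLogSqLaw.Toeplitz
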